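import Summits.Ventures.HSemireg.WedgeHankelRecurrencePositivePairTFAE

/-!
# Venture HSemireg — THE POSITIVE-PAIR DICTIONARY, ODD DEGREE `2t + 3` (Gantmacher XV §§14–15, the case `n = 2m + 1`: `deg g = deg h`, `s_{−1} = ε_∞ > 0`, `c₀ > 0`) AS ONE `TFAE`: for real `h, g` of
# degree `t + 1` with `lc h > 0`, the following are equivalent — (1) `h(X²) + X·g(X²)` is Hurwitz; (2) `B_{t+2}(h, Xg) ≻ 0 ∧ B_{t+1}(g, h) ≻ 0` (N189); (3) `S ≻ 0 ∧ S^{(1)} ≻ 0 ∧ s_{−1} > 0` (Thm 17);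
# (4) all `D_p, D_p^{(1)} > 0` and `s_{−1} > 0` ((115)–(116)); (5) simple negative roots of `h` with `g·h′ > 0` and `lc g > 0`; (6) INTERLACING `w_0 < u_0 < ⋯ < w_t < u_t < 0`, `lc g > 0` (Def 3); (7) a
# Stieltjes fraction with `c₀ > 0`, `c_i, d_i > 0` (Thm 16); (8) `Ind g/h = t + 1`, `Ind ug/h = −(t + 1)` and `ε_∞ = +1` (Thm 14 (94)–(95), (89))

HONEST FRAMING. Part of the Lean index of the computation cell `pub-hsemireg` (seat p10 gen 40, Sunday typer «UNIFORM-IN-n»).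
A `List.TFAE` over statements already in the tree (N189, N232, N234, N236, N240, N233): no new mathematics, no variety, no cohomology theory, no sheaf, no Ext group and no semiregularity map;
nothing here says that HC / HC_CM / HC_AV holds; no Literature fact (unproved `Prop`) is declared or used.  Custodian versions as in `WedgeHankelSiegelIdeal` (1/3).
SOURCE (cited): F. R. Gantmacher, *The Theory of Matrices* II, Ch. XV §14 (88)–(92), (95), Def 3, Thms 13–16; §15 Thm 17 (113), (116); see the individual leaves for the printed statements.
DEDUP DISCLOSURE (`rg -i tfae Summits/Ventures/HSemireg`, 2026-09-02): N241 `positivePair_even_tfae` (even degree), N223 `routh_hurwitz_tfae`.  The 1 name below: 0 hits tree-wide.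

WHAT IS IN THE TREE.  N189 `forall_re_neg_iff_posDef_bezoutian_and_of_odd`; N232 `forall_re_neg_iff_posDef_hankelSq_markovSeq_of_odd`, `forall_re_neg_iff_forall_det_hankelSq_markovSeq_pos_of_odd`,
`forall_re_neg_iff_roots_even_part_of_odd`; N240 `forall_re_neg_iff_interlacing_of_odd`; N234 `forall_re_neg_iff_exists_stieltjesPair`; N233 `stieltjesPair_posDef`, `coeff_stieltjesPair_snd`; N236
`forall_re_neg_iff_cauchyIndex`; N158 `exists_window_roots` (through N241's import).
THIS FILE (namespace `Summit.Ventures.HSemireg.Wedge.HankelOuter` continued; CHAINED on N241; 0 definitions):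
* §989 **`positivePair_odd_tfae`** (the eight-way equivalence, odd degree `2t + 3`).
CAVEATS.  `deg g = deg h` exactly and `lc h > 0`; `s_{−1}` appears as `lc g ∕ lc h` resp. `g_{t+1}/h_{t+1}` in the items it enters.  Nothing Ext-side.  New names only.
-/

open Module Polynomial
open scoped Matrix Polynomial

namespace Summit.Ventures.HSemireg.Wedge.HankelOuter

open Summit.Ventures.HSemireg.Wedge Summit.Ventures.HSemireg.Wedge.Hankel
open Literature.LinearAlgebra.Matrix.Bezoutian (bezoutian)
open Literature.Algebra.Polynomial (cauchyIndex)

/-! ## §989. The eight-way positive-pair equivalence (odd degree) -/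

/-- **THE POSITIVE-PAIR DICTIONARY (odd degree `2t + 3`): for `deg h = deg g = t + 1`, `lc h > 0`, the following are equivalent: (1) `h(X²) + X·g(X²)` is Hurwitz; (2) `B_{t+2}(h, Xg) ≻ 0 ∧
B_{t+1}(g, h) ≻ 0`; (3) `H_t(s) ≻ 0 ∧ H_t(s∘succ) ≻ 0 ∧ 0 < lc g/lc h`; (4) `0 < lc g/lc h ∧ ∀ k ≤ t, det H_k(s) > 0 ∧ det H_k(s∘succ) > 0`; (5) simple negative roots of `h` with `g·h′ > 0`, and
`0 < lc g/lc h`; (6) interlacing `w_0 < u_0 < w_1 < ⋯ < w_t < u_t < 0` with `lc g > 0`; (7) `(h, g) = a·stieltjesPair (t+1) c d`, `a > 0`, `c₀ > 0`, `c_i, d_i > 0`; (8) `Ind g/h = t + 1 ∧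
Ind ug/h = −(t + 1)` on a window and `0 < g_{t+1}/h_{t+1}`.** [Gantmacher XV §§14–15, the case `n = 2m + 1`; this file, §989] -/
theorem positivePair_odd_tfae (t : ℕ) {h g : ℝ[X]} (hh : h.natDegree = t + 1) (hg : g.natDegree = t + 1) (hlc : 0 < h.leadingCoeff) :
    List.TFAE [
      ∀ z ∈ ((expand ℝ 2 h + Polynomial.X * expand ℝ 2 g).map (algebraMap ℝ ℂ)).roots, z.re < 0,
      (bezoutian (t + 2) h (Polynomial.X * g)).PosDef ∧ (bezoutian (t + 1) g h).PosDef,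
      (hankelSq ℝ t (markovSeq ℝ h g)).PosDef ∧ (hankelSq ℝ t (fun k => markovSeq ℝ h g (k + 1))).PosDef ∧ 0 < g.leadingCoeff / h.leadingCoeff,
      0 < g.leadingCoeff / h.leadingCoeff ∧ ∀ k ≤ t, 0 < (hankelSq ℝ k (markovSeq ℝ h g)).det ∧ 0 < (hankelSq ℝ k (fun j => markovSeq ℝ h g (j + 1))).det,
      (h.Splits ∧ h.Separable ∧ ∀ x ∈ h.roots, x < 0 ∧ 0 < g.eval x * (derivative h).eval x) ∧ 0 < g.leadingCoeff / h.leadingCoeff,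
      ∃ u w : Fin (t + 1) → ℝ, StrictMono u ∧ StrictMono w ∧ h.roots = Finset.univ.val.map u ∧ g.roots = Finset.univ.val.map w ∧ 0 < g.leadingCoeff
          ∧ (∀ i, w i < u i) ∧ (∀ j : Fin t, u j.castSucc < w j.succ) ∧ u (Fin.last t) < 0,
      ∃ c d : ℕ → ℝ, 0 < c 0 ∧ (∀ i, 1 ≤ i → i ≤ t + 1 → 0 < c i) ∧ (∀ i, i < t + 1 → 0 < d i)
          ∧ ∃ a : ℝ, 0 < a ∧ h = C a * (stieltjesPair ℝ (t + 1) c d).1 ∧ g = C a * (stieltjesPair ℝ (t + 1) c d).2,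
      ∃ lo hi : ℝ, (∀ x ∈ h.roots, lo < x ∧ x < hi) ∧ cauchyIndex h g lo hi = (t + 1 : ℕ) ∧ cauchyIndex h (Polynomial.X * g) lo hi = -((t + 1 : ℕ) : ℤ)
          ∧ 0 < g.coeff (t + 1) / h.coeff (t + 1)] := by
  have hg0 : g ≠ 0 := by rintro rfl; simp at hg
  have hp : (expand ℝ 2 h + Polynomial.X * expand ℝ 2 g).natDegree = 2 * t + 3 := by rw [natDegree_even_add_odd_of_le_right hg0 (by omega), hg]; ring
  have hlcq : g.leadingCoeff / h.leadingCoeff = g.coeff (t + 1) / h.coeff (t + 1) := by rw [leadingCoeff, leadingCoeff, hg, hh]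
  have hgt : g.coeff (t + 1) ≠ 0 := by rw [← hg]; exact leadingCoeff_ne_zero.2 hg0
  have hht : h.coeff (t + 1) ≠ 0 := by rw [← hh]; exact leadingCoeff_ne_zero.2 (leadingCoeff_ne_zero.1 hlc.ne')
  tfae_have 1 ↔ 2 := forall_re_neg_iff_posDef_bezoutian_and_of_odd t h g hp
  tfae_have 1 ↔ 3 := forall_re_neg_iff_posDef_hankelSq_markovSeq_of_odd t hg hh
  tfae_have 1 ↔ 4 := forall_re_neg_iff_forall_det_hankelSq_markovSeq_pos_of_odd t hg hh
  tfae_have 1 ↔ 5 := forall_re_neg_iff_roots_even_part_of_odd t hg hh hlc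
  tfae_have 1 ↔ 6 := forall_re_neg_iff_interlacing_of_odd t hg hh hlc
  tfae_have 1 ↔ 7 := by
    rw [forall_re_neg_iff_exists_stieltjesPair (t + 1) hh hlc hg.le]
    constructor
    · rintro ⟨c, d, hc0, hc, hd, a, ha, h1, h2⟩
      -- `c₀ = g_{t+1}/h_{t+1} ≠ 0`, hence `c₀ > 0`
      obtain ⟨⟨hH, hHlc, -⟩, -, -⟩ := stieltjesPair_posDef (t + 1) c d hc hd
      have htop := coeff_stieltjesPair_snd (t + 1) c d hc hd
      have e2 := congrArg (fun q : ℝ[X] => q.coeff (t + 1)) h2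
      simp only [coeff_C_mul] at e2
      rw [htop] at e2
      have hc00 : c 0 ≠ 0 := fun h0 => hgt (by rw [e2, h0, zero_mul, mul_zero])
      exact ⟨c, d, lt_of_le_of_ne hc0 hc00.symm, hc, hd, a, ha, h1, h2⟩
    · rintro ⟨c, d, hc0', hc, hd, a, ha, h1, h2⟩
      exact ⟨c, d, hc0'.le, hc, hd, a, ha, h1, h2⟩
  tfae_have 1 ↔ 8 := by
    constructor
    · intro H
      obtain ⟨lo, hi, hw⟩ := exists_window_roots h
      obtain ⟨hc0, hi1, hi2⟩ := (forall_re_neg_iff_cauchyIndex (t + 1) hh hlc hg.le hw).1 H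
      exact ⟨lo, hi, hw, hi1, hi2, lt_of_le_of_ne hc0 (div_ne_zero hgt hht).symm⟩
    · rintro ⟨lo, hi, hw, hi1, hi2, hc0⟩
      exact (forall_re_neg_iff_cauchyIndex (t + 1) hh hlc hg.le hw).2 ⟨hc0.le, hi1, hi2⟩
  tfae_finish

end Summit.Ventures.HSemireg.Wedge.HankelOuter
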